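import Mathlib
import Summits.MatrixMultiplication.MatrixMultiplication.Theses.SnSubsetDichotomy
import Literature.RepresentationTheory.FiniteGroups.KLRGradedCellularBasis
import Summits.MatrixMultiplication.MatrixMultiplication.Theorems.SnSubsetDichotomyNoThresholdSubsetTripleOfKlrMDP
import Summits.MatrixMultiplication.MatrixMultiplication.Theorems.SnSubsetDichotomyNoThresholdSubsetTripleDriftHypothesisDefs
import Summits.MatrixMultiplication.MatrixMultiplication.Theorems.SnSubsetDichotomyNoThresholdSubsetTripleShapeBeforeDefs
import Summits.MatrixMultiplication.MatrixMultiplication.Theorems.SnSubsetDichotomyNoThresholdSubsetTriplePairQVTail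
import Summits.MatrixMultiplication.MatrixMultiplication.Theorems.SnSubsetDichotomyNoThresholdSubsetTripleFreedmanSplit

/-!
# Line `klr-graded-polynomial-method` — crux `NoThresholdSubsetTriple` (stmt-MatrixMultiplication-8302) — skeleton v15

v15 (lead c8, 2026-08-17, cycle 8, after wave 1): THE FREEDMAN SPLIT IS A TREE THEOREM — `stub_freedmanSplit` (p163784,
Theorems/SnSubsetDichotomyNoThresholdSubsetTripleFreedmanSplit.lean; helpers p162832 `freedman_compensated_lowerTail`, p163039 `pairDiff_eq_sum_incr`,
p162873 `oneStep_box_bounds`, p162906 `stronglyMeasurable_prefix_pair`, p162544 `box_of_rowLen_colLen`).  Stubs now: K3 `stub_klrGradedBasis`,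
(L1*) `stub_driftHypothesis`, (M) `stub_compensatorLD` — three NAMED ATOMIC statements; J′ and the crux are derived below without sorry of their own.
Report: Lines/klr_graded_polynomial_method-lead-c8.md.

v14 (lead c8, 2026-08-17, cycle 8): J′ (`stub_swPairsMDP`, the open moderate deviation of v8–v13) is RESHAPED AT THE SKELETON LEVEL along the
Freedman split of leads c4–c7 into three registered stubs, and J′ itself becomes a derived theorem of this file:

* `stub_driftHypothesis`  — (L1*) `PlancherelStep.DriftHypothesis` (tree def p158702): a Lyapunov shape functional restoring against
  `q = sqEnergy` on the `3√n`-box.  With it the tree ALREADY proves the quadratic-variation half (Q): `pairQV_tail_of_drift` (p160069).  OPEN.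
* `stub_compensatorLD`    — (M) the COMPENSATOR large deviation: among boxed same-shape pairs, those whose Plancherel growth `ν_t` has
  `400·Σ_{t<n} m(ν_t) ≤ −n`, `m(ν) = Σ_z p_z(ν)·π_z·x_z(ν)` (`p = transProb`, `π = (−1)^{row+col}`, `x = incr`: the conditional drift of the
  J-increment), number at most `n!·e^{−c√n}`.  OPEN (the finite-horizon mixing content; lead c7 report §2b).
* `stub_freedmanSplit`    — THE SPLIT `DriftHypothesis → (M) → J′`: PROVABLE NOW from the tree (Freedman `stub_freedman_exp`, the model theorem
  `condExp_prefix_succ_param`, the increment identity `stub_pairDiff_eq_chargeSum`, `pairQV_tail_of_drift`, the box bounds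
  `abs_incr_le_of_bounded`, GNW `transProb_sum_eq_one`); held by the lead this cycle, helpers fanned out.
* `stub_klrGradedBasis`   — K3, the Literature named fact `KLRGradedCellularBasis` (unchanged).

Composition: `swPairsMDP := stub_freedmanSplit stub_driftHypothesis stub_compensatorLD` (J′, no sorry of its own) and
`NoThresholdSubsetTriple_of := noThresholdSubsetTriple_of_klr_swPairsMDP stub_klrGradedBasis swPairsMDP` (tree theorem p130059) — the crux BY NAME.
Why this shape: after c7 the (Q) half is a tree theorem modulo (L1*); what was missing formally was the split itself and a NAME for the (M) half.
With v14 the open content of the line is exactly two atomic statements about the Plancherel growth (no TPP, no KLR in them) plus K3.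

History: v1 (planner) K3 ∧ K1 ∧ K2 ∧ transfer; v2–v7 (c1–c4) everything but K3 ∧ J′ landed (p97404 p97461 p102927 p104828 p105683 p106580 p108694
p109639 p110266 p127586 p127674 p127715 p128032 p128384 p129312 p129785 p130059); v9–v10 (c5–c6) alternative bridges WINDOW/DEV/MGF/MOMENTS/(U)∧(D)
(p133699 p133807 p133840 p133999 p134410 p136294 p136552); v11–v13 (c7) the (Q)-programme: Freedman p150738, (Q)-lemma p152256/p158025, PlancherelStep
defs p152515, GNW p154104, (L2′)/(L3) p155265/p155417, hook ratio p156094, model theorem p158534/p158944, stopped process p159042, DriftHypothesis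
p158702, `pairQV_tail_of_drift` p160069.  Reports: Lines/klr_graded_polynomial_method-lead-c{1,2,4,5,6,7}.md; this cycle: -lead-c8.md.

DISPROOF USED (cdisprove v8, 2026-08-16 05:20Z, re-read 2026-08-17 13:10Z): unchanged since cycle 4; §9 targets only the dead Loewy line;
`false_without_TPP` / `false_with_pairwise_only` / `holds_without_posConst` / `false_without_n0` are answered inside the landed transfer
(p97404) exactly as recorded in v8; no `Negative/` lemma exists for this crux; no disprover note bears on (L1*), (M) or the split.
-/

set_option linter.dupNamespace false

noncomputable section

open scoped BigOperators

namespace Summit.MatrixMultiplication.MatrixMultiplication.Cruxes.NoThresholdSubsetTriple.KlrGradedPolynomialMethod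

open Summit.MatrixMultiplication.MatrixMultiplication.Theses.SnSubsetDichotomy
open Summit.MatrixMultiplication.MatrixMultiplication.Theorems
open Summit.MatrixMultiplication.MatrixMultiplication.Theorems.PlancherelStep
open Literature.RepresentationTheory.FiniteGroups (TableauPair KLRGradedCellularBasis addableNodes)

/-! ## The stubs -/

/-- **K3 — the KLR graded cellular basis (KNOWN THEOREM = Literature named fact; the line's one fact debt).**
Brundan–Kleshchev 2009 + Hu–Mathas 2010 + Brundan–Kleshchev–Wang 2011, vendored (p98108) as
`Literature.RepresentationTheory.FiniteGroups.KLRGradedCellularBasis`.  Discharged exactly when a literature-prover lands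
`KLRGradedCellularBasis_holds` (XL); until then the crux closes through this line only CONDITIONALLY on it. -/
theorem stub_klrGradedBasis : Literature.RepresentationTheory.FiniteGroups.KLRGradedCellularBasis := by
  sorry

/-- **(L1\*) — the drift hypothesis** (tree def `PlancherelStep.DriftHypothesis`, p158702): a shape functional `V ≥ 0`, `V ∅ = 0`, with
one-step Plancherel drift `Σ_z p_z (V(ν∪z) − V ν) ≤ K − c·sqEnergy ν/√n` on the `3√n`-box, increments `≤ b√n`, conditional second moment
`≤ C(sqEnergy ν + 1)`.  OPEN (lead c7 report §2a: `V = q` passes every shape probed to n = 6400 but fails asymptotically on thin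
parity-aligned tails; `V = q +` inverse-local-density renormalised charge energy passes numerically).  With it, (Q) is the tree theorem
`pairQV_tail_of_drift`. -/
theorem stub_driftHypothesis : PlancherelStep.DriftHypothesis := by
  sorry

/-- **(M) — the compensator large deviation (OPEN; the mixing half of J′).**  For some `c > 0` and all large `n`: the number of
same-shape pairs `ω = (λ, S, T)` of size `n` whose shape lies in the `3√n`-box and whose growth `ν_t = shapeBefore T t` (the prefix
shapes of the second tableau — under the uniform measure this is the Plancherel growth, tree `condExp_prefix_succ`) has compensator
`400·Σ_{t<n} m(ν_t) ≤ −n`, where `m(ν) := Σ_{z addable} transProb ν z · (−1)^{row z + col z} · incr ν z` is the conditional mean of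
the J-increment, is at most `n!·e^{−c√n}`.  A large deviation at speed `√n` for the time-integral of a mean-zero `O(1)` functional of
the shape over `≍ √n` relaxation times (lead c7 report §2b: `E[Δm|ν] = −m/τ′ + e′`, `τ′ ≈ 0.37√n`; sd of the sum `≈ 0.25·n^{3/4}`). -/
theorem stub_compensatorLD :
    ∃ c : ℝ, 0 < c ∧ ∃ n₀ : ℕ, ∀ n ≥ n₀, (Nat.card {ω : TableauPair n //
      (∀ x ∈ ω.1.youngDiagram.cells, (x.1 : ℝ) < 3 * Real.sqrt n ∧ (x.2 : ℝ) < 3 * Real.sqrt n) ∧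
      400 * (∑ t ∈ Finset.range n, ∑ z ∈ addableNodes (shapeBefore (ω.2.2).1 t),
        transProb (shapeBefore (ω.2.2).1 t) z *
          ((-1 : ℝ) ^ (z.1 + z.2) * (incr (shapeBefore (ω.2.2).1 t) z : ℝ))) ≤ -(n : ℝ)} : ℝ) ≤
      (n.factorial : ℝ) * Real.exp (-(c * Real.sqrt (n : ℝ))) := by
  sorry

/-! ## Composition (kernel-checked, no sorry of its own) -/

/-- **J′ — the moderate deviation of the signed SW/NE pair count**, the open stub of skeletons v6–v13 (`stub_swPairsMDP`), now DERIVED: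
the Freedman split (tree theorem `stub_freedmanSplit`, p163784) applied to (L1\*) and (M). -/
theorem swPairsMDP :
    ∃ c : ℝ, 0 < c ∧ ∃ n₀ : ℕ, ∀ n ≥ n₀, (Nat.card {i : TableauPair n // (i.1.youngDiagram.rowLen 0 : ℝ) < 3 *
      Real.sqrt (n : ℝ) ∧ (i.1.youngDiagram.colLen 0 : ℝ) < 3 * Real.sqrt (n : ℝ) ∧ 200 * ((∑ k : Fin n, ∑ j ∈
      Finset.univ.filter (fun j : Fin n => j < k ∧ (i.2.2.1 k).1 < (i.2.2.1 j).1 ∧ (i.2.2.1 j).2 < (i.2.2.1 k).2), (-1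
      : ℤ) ^ ((i.2.2.1 j).1 + (i.2.2.1 j).2 + (i.2.2.1 k).1 + (i.2.2.1 k).2)) - (∑ k : Fin n, ∑ j ∈ Finset.univ.filter
      (fun j : Fin n => j < k ∧ (i.2.2.1 j).1 < (i.2.2.1 k).1 ∧ (i.2.2.1 k).2 < (i.2.2.1 j).2), (-1 : ℤ) ^ ((i.2.2.1
      j).1 + (i.2.2.1 j).2 + (i.2.2.1 k).1 + (i.2.2.1 k).2))) ≤ -(n : ℤ)} : ℝ) ≤ (n.factorial : ℝ) * Real.exp (-(c *
      Real.sqrt (n : ℝ))) :=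
  stub_freedmanSplit stub_driftHypothesis stub_compensatorLD

/-- THE SKELETON, v15: `KLRGradedCellularBasis → J′ → NoThresholdSubsetTriple` is the tree theorem
`noThresholdSubsetTriple_of_klr_swPairsMDP` (p130059), and J′ is `swPairsMDP` above; the conclusion is the route decl
`Summit.MatrixMultiplication.MatrixMultiplication.Theses.SnSubsetDichotomy.NoThresholdSubsetTriple` by name. -/
theorem NoThresholdSubsetTriple_of :
    Summit.MatrixMultiplication.MatrixMultiplication.Theses.SnSubsetDichotomy.NoThresholdSubsetTriple :=
  noThresholdSubsetTriple_of_klr_swPairsMDP stub_klrGradedBasis swPairsMDP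

end Summit.MatrixMultiplication.MatrixMultiplication.Cruxes.NoThresholdSubsetTriple.KlrGradedPolynomialMethod

end
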